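import Mathlib
import Literature.Analysis.FluidPDE.PassiveScalarClassicalEnergy
import Summits.AnomalousDissipation.AnomalousDissipation.Theorems.TwoAndHalfDScalarAnomalySteadySourceFormalDuhamelMajorantToolkit
import HarnessLib

/-!
# Positive semi-definiteness of the classical release kernel (stub F1)

Crux `LimitingAbsorption.FloorUpgrade` (stmt-AnomalousDissipation-15010), line `SketchIdeator1`,
stub `stub_releasePSD`. CLASSICAL setting: `φ s` is the classical release of the smooth profile
`h` at time `s ≥ 0`, i.e. a classical solution of `∂ₜφ + u·∇φ = κΔφ` on `[s, ∞)` with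
`φ s s = h`. The LAG KERNEL `k(t, s) = ⟨h, φ_s(t)⟩ = ∫ h · φ s t` (`t ≥ s`) is positive
semi-definite: for release times `sᵢ ≥ 0` and weights `cᵢ`,
`∑ᵢⱼ cᵢ cⱼ k(sᵢ ∨ sⱼ, sᵢ ∧ sⱼ) ≥ 0` ("energy inequality of impulsive cold starts").

Route: induction over finite sets of indices, inserting an index of maximal release time
(`Finset.induction_on_max_value`). For a finite index set `A` and every `t ≥ maxᵢ sᵢ` the
superposition `Θ_A(t) = ∑_{i ∈ A} cᵢ φ_{sᵢ}(t)` obeys `‖Θ_A(t)‖²_{L²} ≤ Q_A := ∑_{i,j ∈ A} cᵢcⱼKᵢⱼ`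
(`Kᵢⱼ = ∫ h · φ_{sᵢ ∧ sⱼ}(sᵢ ∨ sⱼ)`): inserting `a` with `m = s_a ≥ sᵢ` (`i ∈ A`), `Θ_{A ∪ {a}}`
is a classical solution on `[m, ∞)` (linearity + restriction of the time set), so its `L²` norm
is non-increasing there (`IsClassicalScalarTransportOn.antitoneOn_scalarL2Sq`), and at `t = m`,
`Θ_{A ∪ {a}}(m) = c_a h + Θ_A(m)`, whence
`‖Θ_{A ∪ {a}}(m)‖² = c_a²‖h‖² + 2c_a ∑_{j ∈ A} cⱼ ⟨h, φ_{sⱼ}(m)⟩ + ‖Θ_A(m)‖² ≤ Q_{A ∪ {a}}` by the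
induction hypothesis. Finally `0 ≤ ‖Θ(t)‖² ≤ Q` for `A = univ` and `t = ∑ᵢ sᵢ`.
-/

set_option linter.dupNamespace false

noncomputable section

open MeasureTheory Set Filter Topology
open scoped BigOperators InnerProductSpace

namespace Summit.AnomalousDissipation.AnomalousDissipation.Theorems.FloorUpgradeLine

namespace ReleasePSD

open Literature.Analysis.FunctionSpaces Literature.Analysis.FluidPDE
open Summit.AnomalousDissipation.AnomalousDissipation.Theorems.ScalarAnomalySteadySourceFormal.DuhamelMajorant

/-- **Linearity, sums**: the sum of two classical solutions of `∂ₜθ + u·∇θ = κΔθ` on a time set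
of unique differentiability is a classical solution. [folklore] -/
theorem unforced_add {d : Type*} [Fintype d] [DecidableEq d] {S : Set ℝ} {κ : ℝ}
    {u : ℝ → UnitAddTorus d → EuclideanSpace ℝ d} {θ ψ : ℝ → UnitAddTorus d → ℝ}
    (hU : UniqueDiffOn ℝ S) (h₁ : Torus.IsClassicalScalarTransportOn S κ u θ)
    (h₂ : Torus.IsClassicalScalarTransportOn S κ u ψ) :
    Torus.IsClassicalScalarTransportOn S κ u (fun t x => θ t x + ψ t x) := by
  have h := unforced_sub hU h₁ (unforced_const_mul hU h₂ (-1))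
  simpa only [neg_one_mul, sub_neg_eq_add] using h

/-- **Linearity, finite linear combinations**: `∑_{i ∈ A} cᵢ θᵢ` is a classical solution of
`∂ₜθ + u·∇θ = κΔθ` on a time set of unique differentiability whenever every `θᵢ` is (a base
solution `θ₀` supplies the velocity data for the empty sum, `0 = θ₀ - θ₀`). [folklore] -/
theorem unforced_sum {d : Type*} [Fintype d] [DecidableEq d] {ι : Type*} [DecidableEq ι]
    {S : Set ℝ} {κ : ℝ} {u : ℝ → UnitAddTorus d → EuclideanSpace ℝ d}
    {θ₀ : ℝ → UnitAddTorus d → ℝ} {θ : ι → ℝ → UnitAddTorus d → ℝ}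
    (hU : UniqueDiffOn ℝ S) (h₀ : Torus.IsClassicalScalarTransportOn S κ u θ₀) (A : Finset ι)
    (hθ : ∀ i ∈ A, Torus.IsClassicalScalarTransportOn S κ u (θ i)) (c : ι → ℝ) :
    Torus.IsClassicalScalarTransportOn S κ u (fun t x => ∑ i ∈ A, c i * θ i t x) := by
  induction A using Finset.induction_on with
  | empty =>
    have h := unforced_sub hU h₀ h₀
    simpa only [sub_self, Finset.sum_empty] using h
  | insert a A ha ih =>
    have h := unforced_add hU (unforced_const_mul hU (hθ a (Finset.mem_insert_self a A)) (c a))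
      (ih fun i hi => hθ i (Finset.mem_insert_of_mem hi))
    simpa only [Finset.sum_insert ha] using h

/-- **The energy bound behind positive semi-definiteness.** For classical releases `φ s` of `h`
(`s ≥ 0`), weights `cᵢ`, release times `sᵢ ≥ 0` and a finite index set `A`, the superposition
`Θ_A(t) = ∑_{i ∈ A} cᵢ φ_{sᵢ}(t)` satisfies, for every `t ≥ 0` with `t ≥ sᵢ` (`i ∈ A`),
`‖Θ_A(t)‖²_{L²} ≤ ∑_{i, j ∈ A} cᵢ cⱼ ∫ h · φ_{sᵢ ∧ sⱼ}(sᵢ ∨ sⱼ)` (induction inserting an index of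
maximal release time; `L²` decay of classical solutions). [folklore] -/
theorem integral_sq_sum_le {d : Type*} [Fintype d] [DecidableEq d] {ι : Type*} [DecidableEq ι]
    {κ : ℝ} {u : ℝ → UnitAddTorus d → EuclideanSpace ℝ d} {h : UnitAddTorus d → ℝ}
    {φ : ℝ → ℝ → UnitAddTorus d → ℝ} (hκ : 0 ≤ κ) (hh : Torus.IsSmooth h)
    (hφ : ∀ s, 0 ≤ s → Torus.IsClassicalScalarTransportOn (Ici s) κ u (φ s) ∧ φ s s = h)
    (s c : ι → ℝ) (hs : ∀ i, 0 ≤ s i) (A : Finset ι) :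
    ∀ t, 0 ≤ t → (∀ i ∈ A, s i ≤ t) →
      ∫ x, (∑ i ∈ A, c i * φ (s i) t x) ^ 2 ≤
        ∑ i ∈ A, ∑ j ∈ A, c i * c j * ∫ x, h x * φ (min (s i) (s j)) (max (s i) (s j)) x := by
  induction A using Finset.induction_on_max_value s with
  | empty =>
    intro t _ _
    simp
  | insert a A ha hmax ih =>
    intro t _ hst
    have hmt : s a ≤ t := hst a (Finset.mem_insert_self a A)
    have hφm : φ (s a) (s a) = h := (hφ (s a) (hs a)).2
    have hU : UniqueDiffOn ℝ (Ici (s a)) := uniqueDiffOn_Ici (s a)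
    -- every release indexed by `insert a A` is a classical solution on `[s a, ∞)`
    have hcl : ∀ i ∈ insert a A,
        Torus.IsClassicalScalarTransportOn (Ici (s a)) κ u (φ (s i)) := by
      intro i hi
      have hle : s i ≤ s a := by
        rcases Finset.mem_insert.1 hi with rfl | hi'
        · exact le_rfl
        · exact hmax i hi'
      exact (hφ (s i) (hs i)).1.restrict (Ici_subset_Ici.2 hle) hU
    -- hence so is the superposition, whose `L²` norm therefore decays on `[s a, t]`
    have hΘ : Torus.IsClassicalScalarTransportOn (Ici (s a)) κ u
        (fun τ x => ∑ i ∈ insert a A, c i * φ (s i) τ x) :=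
      unforced_sum hU (hcl a (Finset.mem_insert_self a A)) (insert a A) hcl c
    have hanti := hΘ.antitoneOn_scalarL2Sq hκ (a := s a) (b := t) Icc_subset_Ici_self
    have hdec : ∫ x, (∑ i ∈ insert a A, c i * φ (s i) t x) ^ 2 ≤
        ∫ x, (∑ i ∈ insert a A, c i * φ (s i) (s a) x) ^ 2 :=
      hanti (left_mem_Icc.2 hmt) (right_mem_Icc.2 hmt) hmt
    refine hdec.trans ?_
    -- the slices at time `s a`
    have hsl : ∀ i ∈ A, Torus.IsSmooth (φ (s i) (s a)) := fun i hi =>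
      (hφ (s i) (hs i)).1.smooth_scalar.isSmooth_slice (mem_Ici.2 (hmax i hi))
    have hGc : Continuous fun x => ∑ i ∈ A, c i * φ (s i) (s a) x :=
      continuous_finsetSum A fun i hi => continuous_const.mul (hsl i hi).continuous
    have hhc : Continuous h := hh.continuous
    have i1 : Integrable (fun x => c a * c a * (h x * h x)) volume :=
      (continuous_const.mul (hhc.mul hhc)).integrable_unitAddTorus
    have i2 : Integrable (fun x => 2 * c a * (h x * ∑ i ∈ A, c i * φ (s i) (s a) x)) volume :=
      (continuous_const.mul (hhc.mul hGc)).integrable_unitAddTorus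
    have i3 : Integrable (fun x => (∑ i ∈ A, c i * φ (s i) (s a) x) ^ 2) volume :=
      (hGc.pow 2).integrable_unitAddTorus
    have i12 : Integrable (fun x => c a * c a * (h x * h x) +
        2 * c a * (h x * ∑ i ∈ A, c i * φ (s i) (s a) x)) volume := i1.add i2
    -- the cross term `⟨h, Θ_A(s a)⟩`
    have hint : ∀ i ∈ A, Integrable (fun x => c i * (h x * φ (s i) (s a) x)) volume :=
      fun i hi => (continuous_const.mul (hhc.mul (hsl i hi).continuous)).integrable_unitAddTorus
    have hcross : ∫ x, h x * ∑ i ∈ A, c i * φ (s i) (s a) x =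
        ∑ i ∈ A, c i * ∫ x, h x * φ (s i) (s a) x := by
      have hfun : (fun x => h x * ∑ i ∈ A, c i * φ (s i) (s a) x) =
          fun x => ∑ i ∈ A, c i * (h x * φ (s i) (s a) x) := by
        funext x
        rw [Finset.mul_sum]
        exact Finset.sum_congr rfl fun i _ => by ring
      rw [hfun, integral_finsetSum A hint]
      exact Finset.sum_congr rfl fun i _ => integral_const_mul _ _
    -- expand `‖c_a h + Θ_A(s a)‖²`
    have hL : ∫ x, (∑ i ∈ insert a A, c i * φ (s i) (s a) x) ^ 2 =
        c a * c a * (∫ x, h x * h x) +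
          2 * c a * (∑ i ∈ A, c i * ∫ x, h x * φ (s i) (s a) x) +
          ∫ x, (∑ i ∈ A, c i * φ (s i) (s a) x) ^ 2 := by
      have hfun : (fun x => (∑ i ∈ insert a A, c i * φ (s i) (s a) x) ^ 2) = fun x =>
          c a * c a * (h x * h x) + 2 * c a * (h x * ∑ i ∈ A, c i * φ (s i) (s a) x) +
            (∑ i ∈ A, c i * φ (s i) (s a) x) ^ 2 := by
        funext x
        rw [Finset.sum_insert ha, hφm]
        ring
      rw [hfun, integral_add i12 i3, integral_add i1 i2, integral_const_mul, integral_const_mul,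
        hcross]
    -- expand the double sum over `insert a A`
    have hKa : ∑ j ∈ A, c a * c j * ∫ x, h x * φ (min (s a) (s j)) (max (s a) (s j)) x =
        c a * ∑ j ∈ A, c j * ∫ x, h x * φ (s j) (s a) x := by
      rw [Finset.mul_sum]
      refine Finset.sum_congr rfl fun j hj => ?_
      rw [min_eq_right (hmax j hj), max_eq_left (hmax j hj)]
      ring
    have hKa' : ∑ i ∈ A, c i * c a * ∫ x, h x * φ (min (s i) (s a)) (max (s i) (s a)) x =
        c a * ∑ i ∈ A, c i * ∫ x, h x * φ (s i) (s a) x := by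
      rw [Finset.mul_sum]
      refine Finset.sum_congr rfl fun i hi => ?_
      rw [min_eq_left (hmax i hi), max_eq_right (hmax i hi)]
      ring
    have hR : ∑ i ∈ insert a A, ∑ j ∈ insert a A,
          c i * c j * ∫ x, h x * φ (min (s i) (s j)) (max (s i) (s j)) x =
        c a * c a * (∫ x, h x * h x) +
          c a * (∑ j ∈ A, c j * ∫ x, h x * φ (s j) (s a) x) +
          c a * (∑ i ∈ A, c i * ∫ x, h x * φ (s i) (s a) x) +
          ∑ i ∈ A, ∑ j ∈ A, c i * c j * ∫ x, h x * φ (min (s i) (s j)) (max (s i) (s j)) x := by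
      simp only [Finset.sum_insert ha, Finset.sum_add_distrib]
      rw [min_self, max_self, hφm, hKa, hKa']
      ring
    rw [hL, hR]
    have hih := ih (s a) (hs a) hmax
    linarith

end ReleasePSD

/-- **F1.** Positive semi-definiteness of the classical release kernel ("energy inequality of
impulsive cold starts"): if `φ s` (`s ≥ 0`) is the classical solution of `∂ₜφ + u·∇φ = κΔφ` on
`[s, ∞)` released from the smooth profile `h` at time `s`, then for all release times `sᵢ ≥ 0`
and weights `cᵢ`, `∑ᵢⱼ cᵢ cⱼ ∫ h · φ_{sᵢ ∧ sⱼ}(sᵢ ∨ sⱼ) ≥ 0`. Indeed the double sum dominates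
`‖∑ᵢ cᵢ φ_{sᵢ}(t)‖²_{L²} ≥ 0` for `t ≥ maxᵢ sᵢ` (`ReleasePSD.integral_sq_sum_le`). [folklore] -/
theorem stub_releasePSD (κ : ℝ) (u : ℝ → UnitAddTorus (Fin 2) → EuclideanSpace ℝ (Fin 2))
    (h : UnitAddTorus (Fin 2) → ℝ) (φ : ℝ → ℝ → UnitAddTorus (Fin 2) → ℝ) (hκ : 0 < κ)
    (hh : Literature.Analysis.FunctionSpaces.Torus.IsSmooth h)
    (hφ : ∀ s, 0 ≤ s →
      Literature.Analysis.FluidPDE.Torus.IsClassicalScalarTransportOn (Ici s) κ u (φ s) ∧ φ s s = h)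
    (n : ℕ) (s c : Fin n → ℝ) (hs : ∀ i, 0 ≤ s i) :
    0 ≤ ∑ i, ∑ j, c i * c j * ∫ x, h x * φ (min (s i) (s j)) (max (s i) (s j)) x := by
  have hT : ∀ i ∈ (Finset.univ : Finset (Fin n)), s i ≤ ∑ j, s j := fun i _ =>
    Finset.single_le_sum (fun j _ => hs j) (Finset.mem_univ i)
  have h0 : 0 ≤ ∑ j, s j := Finset.sum_nonneg fun j _ => hs j
  have hle := ReleasePSD.integral_sq_sum_le hκ.le hh hφ s c hs Finset.univ (∑ j, s j) h0 hT
  exact (integral_nonneg fun x => sq_nonneg _).trans hle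

end Summit.AnomalousDissipation.AnomalousDissipation.Theorems.FloorUpgradeLine

end
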